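import Literature.NumberTheory.ComplexMultiplication.ReflexNormArtinMap
import Literature.NumberTheory.AdelicBaseChange.AdeleNormTower
import Literature.NumberTheory.NumberFields.CMFieldHasseNorm
import HarnessLib

/-!
# «(68) shows that it is also a local norm at the finite primes»: a totally positive `b ∈ F` of the form `t · ι_E t`,
# `t` a finite idèle of the CM field `E ⊃ F`, is `e · ē` with `e ∈ E^×` (Milne, *Complex Multiplication*, proof of
# Lemma 9.14; Milne 2007, proof of Thm. 3.10 / Lemma 3.12)

Layer `Literature/NumberTheory/ComplexMultiplication`; namespace `Literature.NumberTheory.ComplexMultiplication`.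
Lane `lit-hodgefound` (Track 2, Layer A3 skeleton seat `skel-3`, row A3-G43 FILE 2 of 2, the rider of
`…NumberFields/CMFieldHasseNorm`).  THEOREMS ONLY, all proved; no definition, no named fact (D-0026, net debt 0).
Inputs: FILE 1 (the Hasse-norm step from the local conditions), `…ReflexNormArtinMap` §1 (`ι_E` on `𝔸_{E,f}`:
`finiteAdeleComplexConj`, `finiteIdeleComplexConj`), the vendored finite-adelic base change
(`IsDedekindDomain.FiniteAdeleRing.mapSemialgHom` = Cassels's conorm `con_{E/F}` on finite adèles and the
isomorphism `E ⊗_F 𝔸_{F,f} ≅ 𝔸_{E,f}`, Cassels–Fröhlich II (14.2); its transitivity (19.3) `…AdelicBaseChange/AdeleNormTower`).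

## The print, verbatim

J. S. Milne, *Complex Multiplication* (version July 14, 2020), Ch. II §9, proof of LEMMA 9.14 (p. 79) = J. S. Milne, *The
fundamental theorem of complex multiplication*, arXiv:0705.3446, §3.4, proof of Thm. 3.10 (p0017 L10–L22):

> «Let `t = η(σ)/N_Φ(s)`. Then `t · t̄ = 1/ac ∈ F_{≫0}`. (68)  Being a totally positive element of `F`, `ac` is a local
> norm from `E` at the infinite primes, and (68) shows that it is also a local norm at the finite primes. Therefore we
> can write `ac = e · ē` for some `e ∈ E^×`. Then `te · \overline{te} = 1`.»

## What is proved (`L` a CM field = Milne's `E`, `L⁺ = maximalRealSubfield L` = `F`, `ι = finiteAdeleComplexConj L` on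
`𝔸_{L,f}`, `con = FiniteAdeleRing.mapSemialgHom (𝓞 L⁺) L⁺ L (𝓞 L) : 𝔸_{L⁺,f} → 𝔸_{L,f}`)

* §1 `ι` FIXES `con(𝔸_{L⁺,f})` (`finiteAdeleComplexConj_mapSemialgHom`; through `𝔸_{L⁺,f} = 𝔸_{ℚ,f} ⊗ L⁺` and (19.3)).
* §2 `𝔸_{L,f} = con 𝔸_{L⁺,f} ⊕ α · con 𝔸_{L⁺,f}` for `L = L⁺(α)`, `ᾱ = -α` (`exists_eq_mapSemialgHom_add_mul`), and the
  norm form `(con X + α con Y) · ι(con X + α con Y) = con(X² - θY²)` (`…_mul_conj_eq`).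
* §3 **«(68) shows that it is also a local norm at the finite primes»**: if `t · ι t = b ∈ L⁺` for some `t ∈ 𝔸_{L,f}`
  then `x² - θy² = b` is soluble in `L⁺_v` at every finite prime `v` of `L⁺`
  (`exists_sq_sub_mul_sq_eq_of_mul_finiteAdeleComplexConj_eq`).
* §4 **THE SENTENCE**: `b ∈ L⁺` totally positive with `b = t · ι t`, `t ∈ 𝔸_{L,f}` ⇒ `b = e · ē`, `e ∈ L`
  (`IsCMField.exists_eq_mul_complexConj_of_eq_mul_finiteAdeleComplexConj`), and «Then `te · \overline{te} = 1`»: for a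
  finite idèle `t` with `t · ι t · c = 1`, `c ∈ F_{≫0}`, there is `e ∈ E^×` with `te · ι(te) = 1`
  (`exists_mul_unitEmbedding_mul_finiteIdeleComplexConj_eq_one`).

NOT HERE (Layer B): Lemma 9.14 / 3.12 themselves and (63)–(67) (the geometric `η(σ)`, the polarization computation giving
`c ∈ F_{≫0}`), Theorem 9.10 / 3.10.

## References

* J. S. Milne, *Complex Multiplication* (2006; version July 14, 2020), Ch. II §9, proof of Lemma 9.14 (p. 79). [MilneCM2006]
* J. S. Milne, *The fundamental theorem of complex multiplication*, arXiv:0705.3446 (2007), §3.4, proof of Thm. 3.10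
  (after Lemma 3.12). [Milne2007FundamentalCM]
* J. W. S. Cassels, *Global fields*, Ch. II of Cassels–Fröhlich, *Algebraic Number Theory* (1967), §14 (14.2), §19 (19.3). [CasselsFrohlichANT1967]

## Provenance

Lane `lit-hodgefound`, seat `literature-prover-lit-hodgefound-skel-3-g27-0` (row A3-G43, FILE 2 of 2).
-/

set_option autoImplicit false

noncomputable section

open scoped TensorProduct NumberField NumberField.AdeleRing

namespace Literature.NumberTheory.ComplexMultiplication

open Literature.NumberTheory.AdelicBaseChange
open Literature.NumberTheory.NumberFields
open NumberField NumberField.InfinitePlace IsDedekindDomain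

variable (L : Type) [Field L] [NumberField L] [IsCMField L]


/-! ## §1. `ι` fixes the conorm of `𝔸_{L⁺,f}` -/

section ConFixed

/-- `ι ((a) · con_{L/ℚ} r) = (ā) · con_{L/ℚ} r` for `a ∈ L`, `r ∈ 𝔸_{ℚ,f}`: `ι` is `1 ⊗ ῑ` on `𝔸_{ℚ,f} ⊗_ℚ L = 𝔸_{L,f}`.
[cite: MilneCM2006, Ch. II §9, Lemma 9.7 («ι_E» on 𝔸_{f,E})] [cite: CasselsFrohlichANT1967, Ch. II §14 Lemma (14.2)] -/
theorem finiteAdeleComplexConj_algebraMap_mul_mapSemialgHom_rat (a : L) (r : FiniteAdeleRing (𝓞 ℚ) ℚ) :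
    finiteAdeleComplexConj L (algebraMap L _ a * FiniteAdeleRing.mapSemialgHom (𝓞 ℚ) ℚ L (𝓞 L) r) =
      algebraMap L _ (IsCMField.complexConj L a) * FiniteAdeleRing.mapSemialgHom (𝓞 ℚ) ℚ L (𝓞 L) r := by
  have h : (ratFiniteAdeleTensorEquiv L).symm
      (algebraMap L _ a * FiniteAdeleRing.mapSemialgHom (𝓞 ℚ) ℚ L (𝓞 L) r) = r ⊗ₜ a := by
    rw [RingEquiv.symm_apply_eq, ratFiniteAdeleTensorEquiv_tmul]
  rw [finiteAdeleComplexConj_apply, h, conjPoints_tmul, ratFiniteAdeleTensorEquiv_tmul]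

/-- `ι (con_{L/ℚ} r) = con_{L/ℚ} r`: `ι` is `𝔸_{ℚ,f}`-linear. [cite: MilneCM2006, Ch. II §9, Lemma 9.7] -/
theorem finiteAdeleComplexConj_mapSemialgHom_rat (r : FiniteAdeleRing (𝓞 ℚ) ℚ) :
    finiteAdeleComplexConj L (FiniteAdeleRing.mapSemialgHom (𝓞 ℚ) ℚ L (𝓞 L) r) =
      FiniteAdeleRing.mapSemialgHom (𝓞 ℚ) ℚ L (𝓞 L) r := by
  simpa only [map_one, one_mul] using finiteAdeleComplexConj_algebraMap_mul_mapSemialgHom_rat L 1 r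

omit [IsCMField L] in
/-- `con_{L/L⁺}((f) · con_{L⁺/ℚ} r) = (f) · con_{L/ℚ} r` (conorm of principal adèles and transitivity (19.3)).
[cite: CasselsFrohlichANT1967, Ch. II §19 (19.3) and «for principal adeles the conorm map is just the usual injection»] -/
theorem mapSemialgHom_algebraMap_mul_mapSemialgHom_rat (f : (maximalRealSubfield L)) (r : FiniteAdeleRing (𝓞 ℚ) ℚ) :
    FiniteAdeleRing.mapSemialgHom (𝓞 (maximalRealSubfield L)) (maximalRealSubfield L) L (𝓞 L)
        (algebraMap (maximalRealSubfield L) _ f * FiniteAdeleRing.mapSemialgHom (𝓞 ℚ) ℚ (maximalRealSubfield L) (𝓞 (maximalRealSubfield L)) r) =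
      algebraMap L _ (algebraMap (maximalRealSubfield L) L f) * FiniteAdeleRing.mapSemialgHom (𝓞 ℚ) ℚ L (𝓞 L) r := by
  rw [map_mul, finiteAdeleRing_mapSemialgHom_mapSemialgHom ℚ (maximalRealSubfield L) L r]
  congr 1
  exact ContinuousSemialgHom.commutes _ _ _ (FiniteAdeleRing.mapSemialgHom (𝓞 (maximalRealSubfield L)) (maximalRealSubfield L) L (𝓞 L)) f

/-- **`ι` fixes `con(𝔸_{L⁺,f}) ⊆ 𝔸_{L,f}` pointwise**: `ι (con y) = con y` for every finite adèle `y` of the maximal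
totally real subfield (every `y` is a sum of `(f) · con_{L⁺/ℚ} r`, `f ∈ L⁺`, `r ∈ 𝔸_{ℚ,f}`, by (14.2), and `f̄ = f`).
[cite: MilneCM2006, Ch. II §9, Lemma 9.7 («ι_E» on 𝔸_{f,E})] [cite: CasselsFrohlichANT1967, Ch. II §14 Lemma (14.2), §19 (19.3)] -/
theorem finiteAdeleComplexConj_mapSemialgHom (y : FiniteAdeleRing (𝓞 (maximalRealSubfield L)) (maximalRealSubfield L)) :
    finiteAdeleComplexConj L (FiniteAdeleRing.mapSemialgHom (𝓞 (maximalRealSubfield L)) (maximalRealSubfield L) L (𝓞 L) y) =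
      FiniteAdeleRing.mapSemialgHom (𝓞 (maximalRealSubfield L)) (maximalRealSubfield L) L (𝓞 L) y := by
  obtain ⟨z, rfl⟩ := (ratFiniteAdeleTensorEquiv (maximalRealSubfield L)).surjective y
  induction z using TensorProduct.induction_on with
  | zero => simp only [map_zero]
  | tmul r f =>
    rw [ratFiniteAdeleTensorEquiv_tmul, mapSemialgHom_algebraMap_mul_mapSemialgHom_rat,
      finiteAdeleComplexConj_algebraMap_mul_mapSemialgHom_rat, AlgEquiv.commutes]
  | add x y hx hy => simp only [map_add, hx, hy]

end ConFixed

/-! ## §2. `𝔸_{L,f} = con 𝔸_{L⁺,f} ⊕ α · con 𝔸_{L⁺,f}` and the norm form -/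

section Decomposition

variable {L}

omit [IsCMField L] in
/-- `con (f · y) = (f) · con y` for `f ∈ L⁺` (the conorm is `L⁺`-semilinear). [cite: CasselsFrohlichANT1967, Ch. II §19 («for principal adeles …»)] -/
theorem mapSemialgHom_algebraMap_mul (f : (maximalRealSubfield L)) (y : FiniteAdeleRing (𝓞 (maximalRealSubfield L)) (maximalRealSubfield L)) :
    FiniteAdeleRing.mapSemialgHom (𝓞 (maximalRealSubfield L)) (maximalRealSubfield L) L (𝓞 L) (algebraMap (maximalRealSubfield L) _ f * y) =
      algebraMap L _ (algebraMap (maximalRealSubfield L) L f) * FiniteAdeleRing.mapSemialgHom (𝓞 (maximalRealSubfield L)) (maximalRealSubfield L) L (𝓞 L) y := by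
  rw [map_mul]
  congr 1
  exact ContinuousSemialgHom.commutes _ _ _ (FiniteAdeleRing.mapSemialgHom (𝓞 (maximalRealSubfield L)) (maximalRealSubfield L) L (𝓞 L)) f

/-- **Every finite adèle of `L` is `con X + α · con Y`** with `X, Y` finite adèles of `L⁺`, for `L = L⁺(α)`, `ᾱ = -α`,
`α ≠ 0` (`𝔸_{L,f} = L ⊗_{L⁺} 𝔸_{L⁺,f}` by (14.2), and `L = L⁺ ⊕ L⁺α`). [cite: CasselsFrohlichANT1967, Ch. II §14 Lemma (14.2)]
[cite: Milne2007FundamentalCM, §1.1 («E = F[√a]»)] -/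
theorem exists_eq_mapSemialgHom_add_mul {α : L} (hα : IsCMField.complexConj L α = -α) (hα0 : α ≠ 0)
    (T : FiniteAdeleRing (𝓞 L) L) :
    ∃ X Y : FiniteAdeleRing (𝓞 (maximalRealSubfield L)) (maximalRealSubfield L),
      T = FiniteAdeleRing.mapSemialgHom (𝓞 (maximalRealSubfield L)) (maximalRealSubfield L) L (𝓞 L) X +
        algebraMap L _ α * FiniteAdeleRing.mapSemialgHom (𝓞 (maximalRealSubfield L)) (maximalRealSubfield L) L (𝓞 L) Y := by
  obtain ⟨z, rfl⟩ := (FiniteAdeleRing.baseChangeAlgEquiv (𝓞 (maximalRealSubfield L)) (maximalRealSubfield L) L (𝓞 L)).surjective T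
  induction z using TensorProduct.induction_on with
  | zero => exact ⟨0, 0, by simp only [map_zero, mul_zero, add_zero]⟩
  | tmul e y =>
    obtain ⟨f, g, rfl⟩ := IsCMField.exists_eq_add_mul hα hα0 e
    refine ⟨algebraMap (maximalRealSubfield L) _ f * y, algebraMap (maximalRealSubfield L) _ g * y, ?_⟩
    rw [finiteAdeleRing_baseChangeAlgEquiv_tmul, ← finiteAdeleRing_mapSemialgHom_apply_eq_baseChange,
      mapSemialgHom_algebraMap_mul, mapSemialgHom_algebraMap_mul, map_add, map_mul]
    ring
  | add x y hx hy =>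
    obtain ⟨X₁, Y₁, h₁⟩ := hx
    obtain ⟨X₂, Y₂, h₂⟩ := hy
    refine ⟨X₁ + X₂, Y₁ + Y₂, ?_⟩
    rw [map_add, h₁, h₂, map_add, map_add]
    ring

/-- **The norm form on finite adèles: `(con X + α con Y) · ι(con X + α con Y) = con(X² - θY²)`** (`ᾱ = -α`, `α² = θ`;
`ι` fixes `con 𝔸_{L⁺,f}`). [cite: MilneCM2006, Ch. II §9, proof of Lemma 9.14 (p. 79)] -/
theorem mapSemialgHom_add_mul_mul_finiteAdeleComplexConj {α : L} (hα : IsCMField.complexConj L α = -α)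
    {θ : (maximalRealSubfield L)} (hθ : α ^ 2 = algebraMap (maximalRealSubfield L) L θ) (X Y : FiniteAdeleRing (𝓞 (maximalRealSubfield L)) (maximalRealSubfield L)) :
    (FiniteAdeleRing.mapSemialgHom (𝓞 (maximalRealSubfield L)) (maximalRealSubfield L) L (𝓞 L) X +
          algebraMap L _ α * FiniteAdeleRing.mapSemialgHom (𝓞 (maximalRealSubfield L)) (maximalRealSubfield L) L (𝓞 L) Y) *
        finiteAdeleComplexConj L
          (FiniteAdeleRing.mapSemialgHom (𝓞 (maximalRealSubfield L)) (maximalRealSubfield L) L (𝓞 L) X +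
            algebraMap L _ α * FiniteAdeleRing.mapSemialgHom (𝓞 (maximalRealSubfield L)) (maximalRealSubfield L) L (𝓞 L) Y) =
      FiniteAdeleRing.mapSemialgHom (𝓞 (maximalRealSubfield L)) (maximalRealSubfield L) L (𝓞 L) (X ^ 2 - algebraMap (maximalRealSubfield L) _ θ * Y ^ 2) := by
  have hθ' : FiniteAdeleRing.mapSemialgHom (𝓞 (maximalRealSubfield L)) (maximalRealSubfield L) L (𝓞 L) (algebraMap (maximalRealSubfield L) _ θ) = (algebraMap L _ α) ^ 2 := by
    rw [← map_pow, hθ]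
    exact ContinuousSemialgHom.commutes _ _ _ (FiniteAdeleRing.mapSemialgHom (𝓞 (maximalRealSubfield L)) (maximalRealSubfield L) L (𝓞 L)) θ
  rw [map_add, map_mul, finiteAdeleComplexConj_mapSemialgHom, finiteAdeleComplexConj_mapSemialgHom,
    finiteAdeleComplexConj_algebraMap, hα, map_neg, map_sub, map_mul, map_pow, map_pow, hθ']
  ring

end Decomposition

/-! ## §3. «(68) shows that it is also a local norm at the finite primes» -/

section LocalNorm

variable {L}

/-- If `t · ι t = con y` then `y = X² - θY²` in `𝔸_{L⁺,f}` for the coordinates `t = con X + α con Y` (`con` is injective).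
[cite: MilneCM2006, Ch. II §9, proof of Lemma 9.14 (p. 79)] -/
theorem exists_sq_sub_mul_sq_eq_of_mul_finiteAdeleComplexConj_eq_mapSemialgHom {α : L}
    (hα : IsCMField.complexConj L α = -α) (hα0 : α ≠ 0) {θ : (maximalRealSubfield L)} (hθ : α ^ 2 = algebraMap (maximalRealSubfield L) L θ)
    {t : FiniteAdeleRing (𝓞 L) L} {y : FiniteAdeleRing (𝓞 (maximalRealSubfield L)) (maximalRealSubfield L)}
    (ht : t * finiteAdeleComplexConj L t = FiniteAdeleRing.mapSemialgHom (𝓞 (maximalRealSubfield L)) (maximalRealSubfield L) L (𝓞 L) y) :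
    ∃ X Y : FiniteAdeleRing (𝓞 (maximalRealSubfield L)) (maximalRealSubfield L), X ^ 2 - algebraMap (maximalRealSubfield L) _ θ * Y ^ 2 = y := by
  obtain ⟨X, Y, rfl⟩ := exists_eq_mapSemialgHom_add_mul hα hα0 t
  rw [mapSemialgHom_add_mul_mul_finiteAdeleComplexConj hα hθ, finiteAdeleRing_mapSemialgHom_apply_eq_baseChange,
    finiteAdeleRing_mapSemialgHom_apply_eq_baseChange] at ht
  haveI : FaithfulSMul (𝓞 (maximalRealSubfield L)) (𝓞 L) := FaithfulSMul.of_field_isFractionRing (𝓞 (maximalRealSubfield L)) (𝓞 L) (maximalRealSubfield L) L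
  exact ⟨X, Y, Literature.NumberTheory.Automorphic.FiniteAdeleRing.baseChange_injective (𝓞 (maximalRealSubfield L)) (maximalRealSubfield L) L (𝓞 L) ht⟩

/-- **«(68) shows that it is also a local norm at the finite primes»**: if `b ∈ L⁺` satisfies `b = t · ι t` for a finite
adèle `t` of `L`, then `x² - θy² = b` is soluble in `L⁺_v` for every finite prime `v` of `L⁺` — `b` is a local norm
from `L = L⁺(√θ)` at `v`. [cite: MilneCM2006, Ch. II §9, proof of Lemma 9.14 (p. 79)]
[cite: Milne2007FundamentalCM, §3.4, proof of Thm. 3.10 (after Lemma 3.12)] -/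
theorem exists_sq_sub_mul_sq_eq_of_mul_finiteAdeleComplexConj_eq {α : L} (hα : IsCMField.complexConj L α = -α)
    (hα0 : α ≠ 0) {θ : (maximalRealSubfield L)} (hθ : α ^ 2 = algebraMap (maximalRealSubfield L) L θ) {b : (maximalRealSubfield L)} {t : FiniteAdeleRing (𝓞 L) L}
    (ht : t * finiteAdeleComplexConj L t = algebraMap L _ (algebraMap (maximalRealSubfield L) L b))
    (v : HeightOneSpectrum (𝓞 (maximalRealSubfield L))) :
    ∃ x y : v.adicCompletion (maximalRealSubfield L), x ^ 2 - algebraMap (maximalRealSubfield L) _ θ * y ^ 2 = algebraMap (maximalRealSubfield L) _ b := by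
  have hb : algebraMap L (FiniteAdeleRing (𝓞 L) L) (algebraMap (maximalRealSubfield L) L b) =
      FiniteAdeleRing.mapSemialgHom (𝓞 (maximalRealSubfield L)) (maximalRealSubfield L) L (𝓞 L) (algebraMap (maximalRealSubfield L) _ b) :=
    (ContinuousSemialgHom.commutes _ _ _ (FiniteAdeleRing.mapSemialgHom (𝓞 (maximalRealSubfield L)) (maximalRealSubfield L) L (𝓞 L)) b).symm
  rw [hb] at ht
  obtain ⟨X, Y, hXY⟩ := exists_sq_sub_mul_sq_eq_of_mul_finiteAdeleComplexConj_eq_mapSemialgHom hα hα0 hθ ht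
  refine ⟨FiniteAdeleRing.evalAlgebraMap (𝓞 (maximalRealSubfield L)) (maximalRealSubfield L) v X, FiniteAdeleRing.evalAlgebraMap (𝓞 (maximalRealSubfield L)) (maximalRealSubfield L) v Y, ?_⟩
  have h := congrArg (FiniteAdeleRing.evalAlgebraMap (𝓞 (maximalRealSubfield L)) (maximalRealSubfield L) v) hXY
  rwa [map_sub, map_mul, map_pow, map_pow, AlgHom.commutes, AlgHom.commutes] at h

end LocalNorm

/-! ## §4. «Therefore we can write `ac = e · ē`» and «then `te · \overline{te} = 1`» -/

section Sentence

/-- **MILNE CM, PROOF OF LEMMA 9.14 / MILNE 2007, PROOF OF THM. 3.10 — THE HASSE-NORM STEP ON FINITE IDÈLES**: for a CM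
field `L` with maximal totally real subfield `L⁺` and `b ∈ L⁺` TOTALLY POSITIVE («a local norm from `E` at the infinite
primes»), if `b = t · ι t` for some finite adèle `t ∈ 𝔸_{L,f}` («(68) shows that it is also a local norm at the finite
primes») then `b = e · ē` for some `e ∈ L` («Therefore we can write `ac = e · ē` for some `e ∈ E^×`» — Hasse's norm
theorem for `L/L⁺`, FILE 1). [cite: MilneCM2006, Ch. II §9, proof of Lemma 9.14 (p. 79)]
[cite: Milne2007FundamentalCM, §3.4, proof of Thm. 3.10 (after Lemma 3.12)] [cite: Omeara1963, §65D Thm. 65:23] -/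
theorem IsCMField.exists_eq_mul_complexConj_of_eq_mul_finiteAdeleComplexConj {b : (maximalRealSubfield L)}
    (hpos : ∀ v : InfinitePlace (maximalRealSubfield L), 0 < embedding_of_isReal (IsTotallyReal.isReal v) b)
    {t : FiniteAdeleRing (𝓞 L) L} (ht : t * finiteAdeleComplexConj L t = algebraMap L _ (algebraMap (maximalRealSubfield L) L b)) :
    ∃ e : L, algebraMap (maximalRealSubfield L) L b = e * IsCMField.complexConj L e := by
  obtain ⟨θ, α, hα0, hα, hθ, -, -⟩ := IsCMField.exists_ringOfIntegers_totallyNegative_sqrt L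
  exact IsCMField.exists_eq_mul_complexConj_of_forall_isLocalNorm hα hα0 hθ hpos
    (exists_sq_sub_mul_sq_eq_of_mul_finiteAdeleComplexConj_eq hα hα0 hθ ht)

/-- The same with «totally positive» as `∀ φ : L⁺ →+* ℝ, 0 < φ b`.
[cite: MilneCM2006, Ch. II §9, proof of Lemma 9.14 (p. 79)] [cite: Milne2007FundamentalCM, §3.4, proof of Thm. 3.10] -/
theorem IsCMField.exists_eq_mul_complexConj_of_totallyPositive_of_eq_mul_finiteAdeleComplexConj {b : (maximalRealSubfield L)}
    (hpos : ∀ φ : (maximalRealSubfield L) →+* ℝ, 0 < φ b) {t : FiniteAdeleRing (𝓞 L) L}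
    (ht : t * finiteAdeleComplexConj L t = algebraMap L _ (algebraMap (maximalRealSubfield L) L b)) :
    ∃ e : L, algebraMap (maximalRealSubfield L) L b = e * IsCMField.complexConj L e :=
  IsCMField.exists_eq_mul_complexConj_of_eq_mul_finiteAdeleComplexConj L (fun _ => hpos _) ht

/-- **«Then `te · \overline{te} = 1`»**: for a finite idèle `t` of the CM field `L` and `c ∈ L⁺` totally positive with
`t · ι t · c = 1` («`t · t̄ = 1/ac ∈ F_{≫0}` (68)»), there is `e ∈ L^×` with `te · ι(te) = 1` in `𝔸^×_{L,f}`.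
[cite: MilneCM2006, Ch. II §9, proof of Lemma 9.14 (p. 79)] [cite: Milne2007FundamentalCM, §3.4, proof of Thm. 3.10 (after Lemma 3.12)] -/
theorem exists_mul_unitEmbedding_mul_finiteIdeleComplexConj_eq_one {c : (maximalRealSubfield L)}
    (hpos : ∀ v : InfinitePlace (maximalRealSubfield L), 0 < embedding_of_isReal (IsTotallyReal.isReal v) c)
    {t : (FiniteAdeleRing (𝓞 L) L)ˣ}
    (ht : (t : FiniteAdeleRing (𝓞 L) L) * finiteAdeleComplexConj L t * algebraMap L _ (algebraMap (maximalRealSubfield L) L c) = 1) :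
    ∃ e : Lˣ, t * FiniteAdeleRing.unitEmbedding (𝓞 L) L e *
      finiteIdeleComplexConj L (t * FiniteAdeleRing.unitEmbedding (𝓞 L) L e) = 1 := by
  -- `c = t⁻¹ · ι(t⁻¹)` is a norm from `𝔸_{L,f}`
  have hc0 : c ≠ 0 := by
    obtain ⟨v⟩ : Nonempty (InfinitePlace (maximalRealSubfield L)) := inferInstance
    intro h
    have := hpos v
    rw [h, map_zero] at this
    exact lt_irrefl _ this
  have hinv : ((t⁻¹ : (FiniteAdeleRing (𝓞 L) L)ˣ) : FiniteAdeleRing (𝓞 L) L) *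
      finiteAdeleComplexConj L ((t⁻¹ : (FiniteAdeleRing (𝓞 L) L)ˣ) : FiniteAdeleRing (𝓞 L) L) =
        algebraMap L _ (algebraMap (maximalRealSubfield L) L c) := by
    have hu : ((t⁻¹ : (FiniteAdeleRing (𝓞 L) L)ˣ) : FiniteAdeleRing (𝓞 L) L) * t = 1 := by
      rw [← Units.val_mul, inv_mul_cancel, Units.val_one]
    calc ((t⁻¹ : (FiniteAdeleRing (𝓞 L) L)ˣ) : FiniteAdeleRing (𝓞 L) L) *
          finiteAdeleComplexConj L ((t⁻¹ : (FiniteAdeleRing (𝓞 L) L)ˣ) : FiniteAdeleRing (𝓞 L) L)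
        = ((t⁻¹ : (FiniteAdeleRing (𝓞 L) L)ˣ) : FiniteAdeleRing (𝓞 L) L) *
            finiteAdeleComplexConj L ((t⁻¹ : (FiniteAdeleRing (𝓞 L) L)ˣ) : FiniteAdeleRing (𝓞 L) L) *
            ((t : FiniteAdeleRing (𝓞 L) L) * finiteAdeleComplexConj L t * algebraMap L _ (algebraMap (maximalRealSubfield L) L c)) := by
          rw [ht, mul_one]
      _ = (((t⁻¹ : (FiniteAdeleRing (𝓞 L) L)ˣ) : FiniteAdeleRing (𝓞 L) L) * t) *
            finiteAdeleComplexConj L (((t⁻¹ : (FiniteAdeleRing (𝓞 L) L)ˣ) : FiniteAdeleRing (𝓞 L) L) * t) *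
            algebraMap L _ (algebraMap (maximalRealSubfield L) L c) := by
          rw [map_mul]; ring
      _ = algebraMap L _ (algebraMap (maximalRealSubfield L) L c) := by rw [hu, map_one, one_mul, one_mul]
  obtain ⟨e, he⟩ := IsCMField.exists_eq_mul_complexConj_of_eq_mul_finiteAdeleComplexConj L hpos hinv
  have he0 : e ≠ 0 := by
    rintro rfl
    rw [zero_mul, map_eq_zero] at he
    exact hc0 he
  refine ⟨Units.mk0 e he0, Units.ext ?_⟩
  rw [Units.val_mul, Units.val_mul, coe_finiteIdeleComplexConj, Units.val_mul, FiniteAdeleRing.unitEmbedding_apply,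
    Units.val_mk0, map_mul, finiteAdeleComplexConj_algebraMap, Units.val_one]
  calc (t : FiniteAdeleRing (𝓞 L) L) * algebraMap L _ e *
        (finiteAdeleComplexConj L t * algebraMap L _ (IsCMField.complexConj L e))
      = (t : FiniteAdeleRing (𝓞 L) L) * finiteAdeleComplexConj L t *
          algebraMap L _ (e * IsCMField.complexConj L e) := by rw [map_mul]; ring
    _ = 1 := by rw [← he, ht]

end Sentence

end Literature.NumberTheory.ComplexMultiplication

end
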